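import Literature.NumberTheory.GaloisCohomology.Howard2004.CofinalEmbeddingColimitProofs
import Literature.NumberTheory.GaloisCohomology.Howard2004.DVRSelmerATorsionControlProofs
import HarnessLib

/-!
# Howard 2004, Lemma 1.3.3 / §1.6: the kernel of the reduction `H¹(K, T^{(j+D)}) → H¹(K, T^{(j)})` is the
# `π^{e_{j+D}-e_j}`-torsion — `inc ∘ red = π^{e_{j+D}-e_j}` on ALL classes (theorems only)

Topic `NumberTheory/GaloisCohomology/Howard2004` (sequel to `CofinalEmbeddingColimitProofs` §1
`exists_linearMap_incH1LE_eq` (the transition of `A = colim` at the module level) and `DVRSelmerATorsionControlProofs`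
(`DVRSetting.incH1LE_injective`, Lemma 1.3.3)).  THEOREMS ONLY: no definition, no named fact, no instance, no notation,
no `sorry`.

WHY (INPUTS row G87 = `Howard2004.thm161_dvrKolyvaginBound` = Howard Thm. 1.6.1; stub `stub_h161` of the μ-crux
stmt-BirchSwinnertonDyer-22642; cell `pub/bsd-print-x9`, seat `bsd-line-x10b-p1-w7` g8).  The liftability case of
Lemma 1.6.4 (the ENGINE `StubLemmaInductionProofs`, hypothesis `hlift`) reads «Lemma 1.3.3: `red_{k→i} x = 0 ⟺
π^{k-i}x = 0`» (arXiv:1202.6340 p. 11 L85 – p. 12 L9); the tree had `incH1LE (x_k) = π^{…} x_{k+d}` only for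
COMPATIBLE FAMILIES (`incH1LE_apply_eq_scalarMapH1_pow_of_mem_limitH1`).  Here it is for every class:

* `AdicTower.incH1LE_redIterH1_eq_scalarMapH1_pow` — `incH1LE j (j+D) (redIterH1 j D c) = π^{e_{j+D}-e_j} • c`
  (from the module-level transition `φ ∘ red^D = π^{e_{j+D}-e_j}` and functoriality of `H¹`);
* **`DVRSetting.redIterH1_eq_zero_iff`** — on a `DVRSetting` with H.0–H.5: `redIterH1 j D c = 0 ↔
  π^{e_{j+D}-e_j} • c = 0` (`incH1LE` is injective, Lemma 1.3.3).

HONEST FRAMING: `thm161_dvrKolyvaginBound` is NOT proved; no summit statement is proved; the Birch–Swinnerton-Dyer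
conjecture is not proved by any of this.
References: [Howard2004HeegnerKolyvagin] B. Howard, Compositio Math. 140 (2004), Lemma 1.3.3, Lemma 1.6.4 (arXiv:1202.6340
p. 7 L152–160, p. 11 L85 – p. 12 L9, p. 12 L40–48); [SerreGaloisCohomology1997] I §2.2.
-/

set_option autoImplicit false

noncomputable section

open Function NumberField IsDedekindDomain Field
open scoped NumberField ContRepresentation

namespace Literature.NumberTheory.GaloisCohomology.Howard2004

open Literature.NumberTheory.GaloisRepresentations
open Literature.NumberTheory.GaloisRepresentations.DiscreteGaloisModule
open Literature.NumberTheory.GaloisRepresentations.galoisCohomology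

namespace AdicTower

variable {K : Type} [Field K] [NumberField K] {R : Type} [CommRing R] [IsLocalRing R]
  {N : ℕ → Type} [∀ k, AddCommGroup (N k)] [∀ k, TopologicalSpace (N k)] [∀ k, DiscreteTopology (N k)]
  [∀ k, Module R (N k)]
  (T : AdicTower K R N) (π : R) (e : ℕ → ℕ)
  (hkill : ∀ k, ∀ r ∈ IsLocalRing.maximalIdeal R ^ e k, ∀ x : N k, r • x = 0)
  (hker : ∀ k, LinearMap.ker (T.red k) = (IsLocalRing.maximalIdeal R ^ e k) • (⊤ : Submodule R (N (k + 1))))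
  (hπ : π ∈ IsLocalRing.maximalIdeal R) (he : ∀ k, e k ≤ e (k + 1))

/-- **`inc_{j→j+D} (red_{j+D→j} c) = π^{e_{j+D}-e_j} • c` for EVERY class `c ∈ H¹(K, T_{j+D})`** (not only for
compatible families). [cite: Howard2004HeegnerKolyvagin, Lemma 1.3.3 and §1.6 (arXiv p. 7 L152–160, p. 12 L40–48)] -/
theorem incH1LE_redIterH1_eq_scalarMapH1_pow (j D : ℕ) (c : galoisCohomology (T.ρ (j + D)) 1) :
    incH1LE T π e hkill hker hπ he j (j + D) (Nat.le_add_right j D) (T.redIterH1 j D c) =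
      scalarMapH1 (T.ρ (j + D)) (T.hlin (j + D)) (π ^ (e (j + D) - e j)) c := by
  obtain ⟨φ, hφ, hφred, hφH1, -⟩ := exists_linearMap_incH1LE_eq T π e hkill hker hπ he j D
  have hsm : ∀ (g : absoluteGaloisGroup K) (x : N (j + D)),
      DistribSMul.toAddMonoidHom (N (j + D)) (π ^ (e (j + D) - e j)) ((T.ρ (j + D)) g x) =
        (T.ρ (j + D)) g (DistribSMul.toAddMonoidHom (N (j + D)) (π ^ (e (j + D) - e j)) x) :=
    fun g x => ((T.hlin (j + D)) g (π ^ (e (j + D) - e j)) x).symm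
  rw [hφH1, ← cohomologyMap_smul_eq_scalarMapH1 (T.ρ (j + D)) (T.hlin (j + D)) (π ^ (e (j + D) - e j)) hsm]
  exact cohomologyMap_one_comp_eq (T.ρ (j + D)) (T.ρ j) (T.ρ (j + D)) (T.redIter j D).toAddMonoidHom
    (T.redIter_equivariant j D) φ.toAddMonoidHom hφ _ hsm (fun y => hφred y) c

end AdicTower

namespace DVRSetting

variable {p : ℕ} [Fact p.Prime] {K : Type} [Field K] [NumberField K]
  {R : Type} [CommRing R] [IsDomain R] [IsDiscreteValuationRing R] [Algebra ℤ_[p] R]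
  {N : ℕ → Type} [∀ k, AddCommGroup (N k)] [∀ k, TopologicalSpace (N k)] [∀ k, DiscreteTopology (N k)]
  [∀ k, Module R (N k)]
  {Rk : ℕ → Type} [∀ k, CommRing (Rk k)] [∀ k, IsLocalRing (Rk k)] [∀ k, TopologicalSpace (Rk k)]
  [∀ k, DiscreteTopology (Rk k)] [∀ k, Algebra ℤ_[p] (Rk k)] [∀ k, Algebra R (Rk k)]
  [∀ k, Module (Rk k) (N k)] [∀ k, IsScalarTower R (Rk k) (N k)]
  {Nbar : Type} [AddCommGroup Nbar] [TopologicalSpace Nbar] [DiscreteTopology Nbar] [∀ k, Module (Rk k) Nbar]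
  {Nq : ℕ → Finset (HeightOneSpectrum (𝓞 K)) → Type} [∀ k n, AddCommGroup (Nq k n)]
  [∀ k n, TopologicalSpace (Nq k n)] [∀ k n, DiscreteTopology (Nq k n)] [∀ k n, Module (Rk k) (Nq k n)]
  [∀ k n, Module R (Nq k n)] [∀ k n, IsScalarTower R (Rk k) (Nq k n)]

/-- **Lemma 1.3.3, kernel form: `red_{j+D→j} c = 0 ↔ π^{e_{j+D}-e_j} • c = 0`** for every class
`c ∈ H¹(K, T^{(j+D)})` of a `DVRSetting` with H.0–H.5 (`inc ∘ red = π^{e_{j+D}-e_j}`, `inc` injective on `H¹`) — the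
reading of «`red_{k→i} x = 0 ⟺ π^{k-i}x = 0`» in the liftability case of Lemma 1.6.4.
[cite: Howard2004HeegnerKolyvagin, Lemma 1.3.3 and Lemma 1.6.4 (arXiv p. 7 L152–160, p. 11 L85 – p. 12 L9)] -/
theorem redIterH1_eq_zero_iff (S : DVRSetting p K R N Rk Nbar Nq) (hy : S.SatisfiesH) (j D : ℕ)
    (c : galoisCohomology (S.T.ρ (j + D)) 1) :
    S.T.redIterH1 j D c = 0 ↔
      scalarMapH1 (S.T.ρ (j + D)) (S.T.hlin (j + D)) (S.π ^ (S.e (j + D) - S.e j)) c = 0 := by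
  have hπ : S.π ∈ IsLocalRing.maximalIdeal R := by rw [hy.unif]; exact Ideal.mem_span_singleton_self _
  have he : ∀ k, S.e k ≤ S.e (k + 1) := fun k => (hy.e_strictMono (Nat.lt_succ_self k)).le
  rw [← AdicTower.incH1LE_redIterH1_eq_scalarMapH1_pow S.T S.π S.e hy.killed hy.ker_red hπ he j D c]
  constructor
  · intro h; rw [h, map_zero]
  · intro h
    exact S.incH1LE_injective hy hπ he j (j + D) (Nat.le_add_right j D) (h.trans (map_zero _).symm)

end DVRSetting

end Literature.NumberTheory.GaloisCohomology.Howard2004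

end
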